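import Literature.NumberTheory.IwasawaTheory.ClassicalMuVanishesQuadraticAscentShiftReal
import Literature.NumberTheory.IwasawaTheory.ClassicalMuVanishesTwoPowerGaloisRatFull
import HarnessLib

/-!
# `μ₂ = 0` ascends every quadratic / Galois `2`-power extension with TOTALLY REAL top field — NO linear-disjointness proviso
# (Iwasawa 1973 Thm. 2 iterated at `l = 2`; the totally-real twin of `ClassicalMuVanishesTwoPowerGaloisRatFull` §1–§2; proved, no named fact)

`Proofs`-style file (theorems only, no `sorry`) in topic `NumberTheory/IwasawaTheory` (namespace `Literature.NumberTheory.IwasawaTheory`),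
written by the prover seat `bsd-line-att-p3` g36 (cell `bsd-f1-sign2`, route `AlignedTransportAtTwo`, `--supports` stmt-BirchSwinnertonDyer-22298;
closes nothing; nothing about elliptic curves or BSD is asserted).  With this file every «`√2 ∉ K'`» binder of the lineage's `μ₂`-ascents
(`ClassicalMuVanishesQuadraticAscentIntrinsic`, `…TwoPowerAscent`, `…TwoPowerGaloisRat`) has a proviso-free replacement.

* §1 ★★★ **`classicalMu_of_finrank_eq_two_of_isTotallyReal'`** — `K ⊆ K'` number fields, `[K' : K] = 2`, `K'` totally real: «`ClassicalMuVanishes`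
  for every cyclotomic `ℤ₂`-extension of `K`» ⟹ «the same for `K'`» (shifted towers read off `j(K)·ℚ_m ⊆ j'(K')·ℚ_m`, all `m`; per-layer bound
  `padicValNat_card_quotient_fieldRange_sup_layer_le_of_isTotallyReal`).
* §2 ★★ **`classicalMu_of_isGalois_of_finrank_eq_two_pow_of_isTotallyReal'`** — `K'/K` Galois of degree `2^m`, `K'` totally real, ANY base `K`.
* §3 corollaries: `classicalMu_of_isGalois_of_finrank_eq_two_pow_over_quadratic_of_isTotallyReal'` (totally real Galois `2`-power extensions of a
  real quadratic field — its `2`-class field tower in the wide sense, totally real `ℚ(√d, √a₁, …)`, no «`√2 ∉`»);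
  `classicalMu_of_isGalois_two_pow_of_isTotallyReal_of_algebra_isGalois_rat` / `…_of_isTotallyComplex_of_algebra_isGalois_rat` — base ANY totally
  real (resp. totally complex) field embedding in a Galois `2`-power extension of `ℚ` (e.g. `K = ℚ_n`, `ℚ(ζ_{2^s})⁺`, resp. `ℚ(ζ_{2^s})`), top any
  Galois `2`-power `K'/K` totally real (resp. arbitrary).

References: [Iwasawa1973MuInvariants] Thm. 2 and its proof (pp. 7–8), Thm. 3, §3–§4; [Greenberg1976TotallyReal] §1; [Washington1997] §13.1,
§13.3 Prop. 13.23.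
-/

set_option autoImplicit false

noncomputable section

open scoped NumberField Classical
open NumberField Field IntermediateField IsDedekindDomain Module Polynomial

namespace Literature.NumberTheory.IwasawaTheory

open Literature.NumberTheory.EllipticCurves Literature.NumberTheory.EllipticCurves.ZpExtension
  Literature.NumberTheory.GaloisRepresentations Literature.NumberTheory.NumberFields

/-! ## §1 The quadratic step with totally real top, intrinsic and proviso-free -/

set_option maxHeartbeats 400000 in
/-- ★★★ **Iwasawa's `μ₂ = 0` ascends every quadratic extension `K ⊆ K'` with `K'` TOTALLY REAL — NO hypothesis on `K ∩ ℚ_∞` or `K' ∩ ℚ_∞`**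
(Iwasawa 1973 Thm. 2: nothing ramifies at infinity; intrinsic, generator-free, proviso-free twin of g34's `classicalMu_of_sq_eq_of_isTotallyReal`).  If `ClassicalMuVanishes κK` for every cyclotomic `ℤ₂`-extension `κK` of `K`, then
`ClassicalMuVanishes κ'` for every cyclotomic `ℤ₂`-extension `κ'` of `K'`.  Proof: shifted base changes `κ₁` of `K` (`2^a κ₁ = κ ∘ res`, layers
`≅ A_{n+a}`) and `κ₁'` of `K'` (layers `≅ B_{n+a'}`) of the cyclotomic `κ` of `ℚ` are cyclotomic (`isCyclotomic_of_shift`); `μ(κ₁) = 0` bounds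
`rank₂ Cl(A_m)` for all `m` (finitely many `m < a` aside); `padicValNat_card_quotient_fieldRange_sup_layer_le_of_isTotallyReal` bounds `rank₂ Cl(B_m)` for all `m`; bounded ranks give `μ(κ₁') = 0`
(`classicalMuVanishes_of_forall_classGroupPRank_le`), and every cyclotomic `κ'` shares `κ₁'`'s layers.
[cite: Iwasawa1973MuInvariants, Thm. 2 and its proof (pp. 7–8), §3] [cite: Washington1997, §13.1 and §13.3 Prop. 13.23] -/
theorem classicalMu_of_finrank_eq_two_of_isTotallyReal' (K K' : Type) [Field K] [NumberField K] [Field K']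
    [NumberField K'] [Algebra K K'] [IsTotallyReal K'] (hdeg : Module.finrank K K' = 2)
    (hμ : ∀ κK : ZpExtension K 2, κK.IsCyclotomic → ClassicalMuVanishes κK) :
    ∀ κ' : ZpExtension K' 2, κ'.IsCyclotomic → ClassicalMuVanishes κ' := by
  intro κ' hκ'
  haveI : Fact (Nat.Prime 2) := ⟨Nat.prime_two⟩
  haveI : IsScalarTower ℚ K K' := IsScalarTower.of_algebraMap_eq' (Subsingleton.elim _ _)
  haveI : FiniteDimensional K K' := Module.Finite.of_restrictScalars_finite ℚ K K'
  obtain ⟨x, m₀, hm, hx, hgen⟩ := exists_integral_sqrt_generator_of_finrank_eq_two K K' hdeg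
  obtain ⟨κ, hκ⟩ := exists_cyclotomicZpExtension_holds ℚ 2
  set j' : K' →ₐ[ℚ] AlgebraicClosure ℚ := absEmbedding ℚ K' with hj'
  set j : K →ₐ[ℚ] AlgebraicClosure ℚ := j'.comp (IsScalarTower.toAlgHom ℚ K K') with hj
  -- the shifted towers of `K` and `K'`
  obtain ⟨a, κ₁, hs⟩ := exists_zpExtension_shift κ K
  obtain ⟨a', κ₁', hs'⟩ := exists_zpExtension_shift κ K'
  have hκ₁ : κ₁.IsCyclotomic := isCyclotomic_of_shift κ K κ₁ hs hκ
  have hκ₁' : κ₁'.IsCyclotomic := isCyclotomic_of_shift κ K' κ₁' hs' hκ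
  refine (classicalMuVanishes_iff_of_isCyclotomic κ₁' κ' hκ₁' hκ').mp ?_
  -- bounded `2`-ranks of the `A_m`, all `m`
  set rA : ℕ → ℕ := fun n ↦ padicValNat 2 (Nat.card (ClassGroup (𝓞 ↥(j.fieldRange ⊔ κ.layer n)) ⧸
    (powMonoidHom 2 : ClassGroup (𝓞 ↥(j.fieldRange ⊔ κ.layer n)) →* _).range)) with hrA
  set rB : ℕ → ℕ := fun n ↦ padicValNat 2 (Nat.card (ClassGroup (𝓞 ↥(j'.fieldRange ⊔ κ.layer n)) ⧸
    (powMonoidHom 2 : ClassGroup (𝓞 ↥(j'.fieldRange ⊔ κ.layer n)) →* _).range)) with hrB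
  obtain ⟨R, hR⟩ := exists_forall_classGroupPRank_le_of_classicalMuVanishes κ₁ (hμ κ₁ hκ₁)
  have hrAshift : ∀ n, rA (n + a) ≤ R := fun n ↦ by
    have h := hR n
    rwa [classGroupPRank_eq_of_layerSubgroup_eq κ K κ₁ (layerSubgroup_eq_comap_of_shift κ K κ₁ hs n) j] at h
  set R' : ℕ := R + ∑ i ∈ Finset.range a, rA i with hR'
  have hrAle : ∀ n, rA n ≤ R' := fun n ↦ by
    rcases Nat.lt_or_ge n a with hlt | hge
    · have h1 : rA n ≤ ∑ i ∈ Finset.range a, rA i :=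
        Finset.single_le_sum (f := rA) (fun i _ ↦ Nat.zero_le _) (Finset.mem_range.mpr hlt)
      omega
    · obtain ⟨k, rfl⟩ : ∃ k, n = k + a := ⟨n - a, by omega⟩
      exact (hrAshift k).trans (Nat.le_add_right _ _)
  -- the per-layer bound, every `m`
  set T : ℕ := ∑ ℓ ∈ ((Ideal.absNorm (Ideal.span {(4 * m₀ : 𝓞 K)}) : ℤ)).natAbs.primeFactors, Module.finrank ℚ K * ℓ ^ 2 with hT
  have hlayer : ∀ n, rB n ≤ 2 * (2 * R' + T) := fun n ↦ by
    have h := padicValNat_card_quotient_fieldRange_sup_layer_le_of_isTotallyReal κ hκ K K' hm hx hgen j' n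
    have h2 : 2 * (2 * rA n + T) ≤ 2 * (2 * R' + T) := by
      have := hrAle n
      nlinarith
    exact h.trans h2
  -- conclusion for the shifted tower of `K'`
  refine classicalMuVanishes_of_forall_classGroupPRank_le κ₁' (B := 2 * (2 * R' + T)) fun n ↦ ?_
  rw [classGroupPRank_eq_of_layerSubgroup_eq κ K' κ₁' (layerSubgroup_eq_comap_of_shift κ K' κ₁' hs' n) j']
  exact hlayer (n + a')


/-! ## §2 The `2`-power Galois ascent with totally real top — Iwasawa 1973 Thm. 2 iterated, no proviso -/

/-- ★★ **Iwasawa 1973 Thm. 2 iterated at `l = 2`: `μ₂ = 0` ascends every finite GALOIS `2`-POWER extension `K'/K` with `K'` TOTALLY REAL**, for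
the cyclotomic `ℤ₂`-extensions, with NO linear-disjointness proviso (every field of the normal series is totally real, nothing ramifies at
infinity): a Sylow subgroup `H` of order `2^m` has index `2`, hence is normal; `K ⊆ K'^H` is the quadratic step §1 (`K'^H ⊆ K'` totally real), and
`K'/K'^H` is Galois of degree `2^m`. [cite: Iwasawa1973MuInvariants, Thm. 2 and its proof (pp. 7–8)] [cite: Greenberg1976TotallyReal, §1]
[cite: Washington1997, §13.3 Prop. 13.23] -/
theorem classicalMu_of_isGalois_of_finrank_eq_two_pow_of_isTotallyReal' :
    ∀ (m : ℕ) (K K' : Type) [Field K] [NumberField K] [Field K'] [NumberField K'] [Algebra K K']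
      [IsGalois K K'] [IsTotallyReal K'], Module.finrank K K' = 2 ^ m →
      (∀ κK : ZpExtension K 2, κK.IsCyclotomic → ClassicalMuVanishes κK) →
      ∀ κ' : ZpExtension K' 2, κ'.IsCyclotomic → ClassicalMuVanishes κ' := by
  haveI : Fact (Nat.Prime 2) := ⟨Nat.prime_two⟩
  intro m
  induction m with
  | zero =>
    intro K K' _ _ _ _ _ _ _ hdeg hμ κ' hκ'
    haveI : IsScalarTower ℚ K K' := IsScalarTower.of_algebraMap_eq' (Subsingleton.elim _ _)
    haveI : FiniteDimensional K K' := Module.Finite.of_restrictScalars_finite ℚ K K'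
    have hsurj : Function.Surjective (algebraMap K K') := fun x => by
      have hx : x ∈ (⊥ : Subalgebra K K') := by
        rw [Subalgebra.bot_eq_top_of_finrank_eq_one (by rw [hdeg, pow_zero])]; exact Algebra.mem_top
      exact Algebra.mem_bot.mp hx
    -- `K' ≅ K`: descend along the inverse isomorphism `K' → K`
    let e : K ≃+* K' := RingEquiv.ofBijective (algebraMap K K') ⟨(algebraMap K K').injective, hsurj⟩
    letI : Algebra K' K := e.symm.toRingHom.toAlgebra
    exact classicalMuVanishes_of_isCyclotomic_of_finite_noGrowth κ' hκ' K hμ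
  | succ m ih =>
    intro K K' _ _ _ _ _ _ _ hdeg hμ κ' hκ'
    haveI : IsScalarTower ℚ K K' := IsScalarTower.of_algebraMap_eq' (Subsingleton.elim _ _)
    haveI : FiniteDimensional K K' := Module.Finite.of_restrictScalars_finite ℚ K K'
    -- a normal subgroup of index `2`
    have hcardG : Nat.card (K' ≃ₐ[K] K') = 2 ^ (m + 1) := by rw [IsGalois.card_aut_eq_finrank, hdeg]
    obtain ⟨H, hH⟩ := Sylow.exists_subgroup_card_pow_prime 2 (n := m) (G := K' ≃ₐ[K] K')
      (by rw [hcardG]; exact pow_dvd_pow 2 (Nat.le_succ m))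
    have hindex : H.index = 2 := by
      have h1 := H.index_mul_card
      rw [hH, hcardG, pow_succ, mul_comm (2 ^ m) 2] at h1
      exact Nat.eq_of_mul_eq_mul_right (pow_pos two_pos m) h1
    haveI : H.Normal := Subgroup.normal_of_index_eq_two hindex
    -- the intermediate field `M = K'^H`, totally real
    set M : IntermediateField K K' := IntermediateField.fixedField H with hM
    haveI : NumberField ↥M := NumberField.of_module_finite K ↥M
    haveI : IsGalois ↥M K' := IsGalois.tower_top_of_isGalois K ↥M K'
    haveI : Algebra.IsAlgebraic ↥M K' := Algebra.IsAlgebraic.of_finite ↥M K'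
    haveI : IsTotallyReal ↥M := IsTotallyReal.of_algebra ↥M K'
    have hMK' : Module.finrank ↥M K' = 2 ^ m := by rw [hM, IntermediateField.finrank_fixedField_eq_card, hH]
    have hKM : Module.finrank K ↥M = 2 := by
      have h1 := Module.finrank_mul_finrank K ↥M K'
      rw [hMK', hdeg, pow_succ, mul_comm (2 ^ m) 2] at h1
      exact Nat.eq_of_mul_eq_mul_right (pow_pos two_pos m) h1
    -- the quadratic step `K ⊆ M`, then the induction hypothesis for `M ⊆ K'`
    have hμM : ∀ κM : ZpExtension ↥M 2, κM.IsCyclotomic → ClassicalMuVanishes κM :=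
      classicalMu_of_finrank_eq_two_of_isTotallyReal' K ↥M hKM hμ
    exact ih ↥M K' hMK' hμM κ' hκ'

/-! ## §3 Corollaries -/

/-- ★★ **`μ₂ = 0` for every TOTALLY REAL finite Galois `2`-power extension `K'` of a quadratic field `F`, NO «`√2 ∉ K'`»** — e.g. the `2`-class
field tower (wide sense) of a real quadratic field, totally real `ℚ(√d, √a₁, …, √a_r)` (`d = 2` allowed); NOT assumed Galois over `ℚ`.  Base
`μ₂(F) = 0` (tree, genus theory) + §2. [cite: Iwasawa1973MuInvariants, Thm. 2 and its proof (pp. 7–8)] [cite: Greenberg1976TotallyReal, §1]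
[cite: Washington1997, §13.3 Prop. 13.23] -/
theorem classicalMu_of_isGalois_of_finrank_eq_two_pow_over_quadratic_of_isTotallyReal' (F K' : Type) [Field F] [NumberField F]
    [Field K'] [NumberField K'] [Algebra F K'] [IsGalois F K'] [IsTotallyReal K'] (hF : Module.finrank ℚ F = 2)
    (m : ℕ) (hdeg : Module.finrank F K' = 2 ^ m)
    (κ' : ZpExtension K' 2) (hκ' : κ'.IsCyclotomic) : ClassicalMuVanishes κ' :=
  classicalMu_of_isGalois_of_finrank_eq_two_pow_of_isTotallyReal' m F K' hdeg
    (fun κP hκP ↦ classicalMuVanishes_of_finrank_eq_two F hF κP hκP) κ' hκ'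

/-- ★★ **`μ₂ = 0` for every TOTALLY REAL Galois `2`-power extension `K'` of ANY number field `K` that embeds in a finite Galois `2`-power extension
`L` of `ℚ`** (e.g. `K = ℚ_n = ℚ(ζ_{2^{n+2}})⁺`, `K` a totally real `C₄`/`D₄` quartic, …; `K'/K` NOT assumed Galois over `ℚ`): base `μ₂(K) = 0` by
`classicalMuVanishes_of_algebra_isGalois_rat_of_finrank_eq_two_pow`, then §2. [cite: Iwasawa1973MuInvariants, Thm. 2, Thm. 3 and §3–§4]
[cite: Washington1997, §13.3 Prop. 13.23] -/
theorem classicalMu_of_isGalois_two_pow_of_isTotallyReal_of_algebra_isGalois_rat (K K' L : Type) [Field K] [NumberField K]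
    [Field K'] [NumberField K'] [Algebra K K'] [IsGalois K K'] [IsTotallyReal K'] [Field L] [NumberField L] [Algebra K L]
    [IsGalois ℚ L] (l : ℕ) (hL : Module.finrank ℚ L = 2 ^ l) (m : ℕ) (hdeg : Module.finrank K K' = 2 ^ m)
    (κ' : ZpExtension K' 2) (hκ' : κ'.IsCyclotomic) : ClassicalMuVanishes κ' :=
  classicalMu_of_isGalois_of_finrank_eq_two_pow_of_isTotallyReal' m K K' hdeg
    (fun κP hκP ↦ classicalMuVanishes_of_algebra_isGalois_rat_of_finrank_eq_two_pow K L l hL κP hκP) κ' hκ'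

/-- ★★ **`μ₂ = 0` for every Galois `2`-power extension `K'` of ANY TOTALLY COMPLEX number field `K` that embeds in a finite Galois `2`-power
extension `L` of `ℚ`** (e.g. `K = ℚ(ζ_{2^s})`, `ℚ(i, √2)`, any imaginary subfield of `ℚ(ζ_{2^s})`; `K'` e.g. its `2`-class field tower, Kummer
`2`-power extensions Galois over `K`; NOT assumed Galois over `ℚ`): base by `classicalMuVanishes_of_algebra_isGalois_rat_of_finrank_eq_two_pow`,
ascent by `classicalMu_of_isGalois_of_finrank_eq_two_pow_of_isTotallyComplex'`. [cite: Iwasawa1973MuInvariants, Thm. 3 and §3–§4]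
[cite: Washington1997, §13.3 Prop. 13.23] -/
theorem classicalMu_of_isGalois_two_pow_of_isTotallyComplex_of_algebra_isGalois_rat (K K' L : Type) [Field K] [NumberField K]
    [Field K'] [NumberField K'] [Algebra K K'] [IsGalois K K'] [IsTotallyComplex K] [Field L] [NumberField L] [Algebra K L]
    [IsGalois ℚ L] (l : ℕ) (hL : Module.finrank ℚ L = 2 ^ l) (m : ℕ) (hdeg : Module.finrank K K' = 2 ^ m)
    (κ' : ZpExtension K' 2) (hκ' : κ'.IsCyclotomic) : ClassicalMuVanishes κ' :=
  classicalMu_of_isGalois_of_finrank_eq_two_pow_of_isTotallyComplex' m K K' hdeg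
    (fun κP hκP ↦ classicalMuVanishes_of_algebra_isGalois_rat_of_finrank_eq_two_pow K L l hL κP hκP) κ' hκ'

end Literature.NumberTheory.IwasawaTheory

end
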